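import Mathlib
import Summits.Ventures.PercRepro2.Defs
import Summits.Ventures.PercRepro2.Independence
import Summits.Ventures.PercRepro2.Graph
import Summits.Ventures.PercRepro2.XWForm

/-!
# (XW) is an identity when `o` hangs off `y` by a single edge (PercRepro2, p2)

If the vertex `o` is a leaf whose unique edge `e` goes to `y ≠ o`, then `{y ↔ o} = {e open}`, the
connections `{s ↔ u}`, `{s ↔ y}` (with `s, u ≠ o`) do not depend on `e`, and the cross W-form
`XW(p) = P(aλ) + P(Sa)P(Sλ) − P(a)P(λ) − P(S)P(Saλ)` collapses to
`p_e·P(a) + P(Sa)·p_e·P(S) − P(a)·p_e − P(S)·p_e·P(Sa) = 0`: the pendant family is exactly tight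
for (XW) (and, by `cqh_of_xw`, (CQH) reduces there to the BHK term).  Record P2-G22-WFORM.md §1, §6.

* `conn_of_leaf_eqOn`: connections between vertices other than a leaf `o` do not see the leaf edge;
* `dependsOn_connEvent_of_leaf`: the corresponding `DependsOn` statement;
* `connEvent_leaf_eq_openEdge`: `{y ↔ o} = {e open}` for the leaf edge `e = {y, o}`;
* `xwBil_leaf_eq_zero`: **`XW(p) = 0`** in the pendant family.
-/

namespace Summit.Ventures.PercRepro2

section Leaf

variable {V : Type*} {E : Type*}

/-- If `o` is a leaf with unique edge `e = {y, o}` (`y ≠ o`) and `s, u ≠ o`, a connection `s ↔ u`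
in `ω` survives in any `ω'` agreeing with `ω` off `e`. -/
lemma conn_of_leaf_eqOn {ends : E → Sym2 V} {e : E} {o y : V} (hleaf : ∀ e', o ∈ ends e' → e' = e)
    (hends : ends e = s(y, o)) (hyo : y ≠ o) {ω ω' : Config E}
    (h : ∀ e', e' ≠ e → ω e' = ω' e') {s u : V} (hs : s ≠ o) (hu : u ≠ o)
    (hc : Conn ends ω s u) : Conn ends ω' s u := by
  -- the closed set: the `ω'`-cluster of `s` minus `o`, plus `o` when `y` is in the cluster
  let S : Set V := {x | (x ≠ o ∧ Conn ends ω' s x) ∨ (x = o ∧ Conn ends ω' s y)}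
  have hS : ∀ x ∈ S, ∀ z, (openGraph ends ω).Adj x z → z ∈ S := by
    intro x hx z hxz
    obtain ⟨hxz', e', he', hends'⟩ := openGraph_adj.1 hxz
    rcases hx with ⟨hxo, hx⟩ | ⟨rfl, hy⟩
    · by_cases hee : e' = e
      · -- the leaf edge: `{x, z} = {y, o}` with `x ≠ o` forces `x = y`, `z = o`
        subst hee
        rw [hends] at hends'
        rcases Sym2.eq_iff.1 hends' with ⟨hyx, hoz⟩ | ⟨_, hox⟩
        · subst hyx; subst hoz
          exact Or.inr ⟨rfl, hx⟩
        · exact absurd hox.symm hxo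
      · have he'' : ω' e' = true := by rw [← h e' hee]; exact he'
        have hz : Conn ends ω' s z := conn_trans hx (conn_of_openAdj ⟨e', he'', hends'⟩)
        by_cases hzo : z = o
        · -- an edge at `o` is `e`
          exfalso
          exact hee (hleaf e' (by rw [hends', hzo]; exact Sym2.mem_mk_right _ _))
        · exact Or.inl ⟨hzo, hz⟩
    · -- `x = o`: the only edge at `o` is `e`, so `z = y`
      have hee : e' = e := hleaf e' (by rw [hends']; exact Sym2.mem_mk_left _ _)
      subst hee
      rw [hends] at hends'
      rcases Sym2.eq_iff.1 hends' with ⟨hyx, _⟩ | ⟨hyz, _⟩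
      · exact absurd hyx hyo
      · subst hyz
        exact Or.inl ⟨hyo, hy⟩
  have hsS : s ∈ S := Or.inl ⟨hs, conn_refl ends ω' s⟩
  rcases mem_of_conn_of_closed hS hsS hc with ⟨_, hu'⟩ | ⟨huo, _⟩
  · exact hu'
  · exact absurd huo hu

/-- Connections between vertices other than the leaf `o` are determined by the edges other than
the leaf edge `e`. -/
lemma dependsOn_connEvent_of_leaf {ends : E → Sym2 V} {e : E} {o y : V}
    (hleaf : ∀ e', o ∈ ends e' → e' = e) (hends : ends e = s(y, o)) (hyo : y ≠ o) {s u : V}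
    (hs : s ≠ o) (hu : u ≠ o) :
    DependsOn (· ∈ connEvent ends s u) (({e} : Set E)ᶜ) := by
  intro ω ω' h
  have h' : ∀ e', e' ≠ e → ω e' = ω' e' := fun e' he' => h e' (by simpa using he')
  have h'' : ∀ e', e' ≠ e → ω' e' = ω e' := fun e' he' => (h' e' he').symm
  exact propext ⟨conn_of_leaf_eqOn hleaf hends hyo h' hs hu,
    conn_of_leaf_eqOn hleaf hends hyo h'' hs hu⟩

/-- For a leaf `o` with unique edge `e = {y, o}` (`y ≠ o`): `{y ↔ o} = {e open}`. -/
lemma connEvent_leaf_eq_openEdge {ends : E → Sym2 V} {e : E} {o y : V}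
    (hleaf : ∀ e', o ∈ ends e' → e' = e) (hends : ends e = s(y, o)) (hyo : y ≠ o) :
    connEvent ends y o = openEdge e := by
  ext ω
  constructor
  · intro hc
    by_contra hne
    have he : ω e = false := by
      rcases Bool.eq_false_or_eq_true (ω e) with h | h
      · exact absurd h hne
      · exact h
    -- `{x ≠ o}` is closed under open adjacency when the leaf edge is closed
    have hS : ∀ x ∈ {x : V | x ≠ o}, ∀ z, (openGraph ends ω).Adj x z → z ∈ {x : V | x ≠ o} := by
      intro x _ z hxz hzo
      obtain ⟨_, e', he', hends'⟩ := openGraph_adj.1 hxz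
      have hee : e' = e := hleaf e' (by rw [hends', hzo]; exact Sym2.mem_mk_right _ _)
      subst hee
      rw [he] at he'
      exact Bool.false_ne_true he'
    exact mem_of_conn_of_closed hS (show y ∈ {x : V | x ≠ o} from hyo) hc rfl
  · intro he
    exact conn_of_openAdj ⟨e, he, hends⟩

end Leaf

section LeafIdentity

variable {V : Type*} {E : Type*} [Fintype E] [DecidableEq E]
  {R : Type*} [CommRing R] [LinearOrder R] [IsStrictOrderedRing R]

omit [LinearOrder R] [IsStrictOrderedRing R] in
/-- **(XW) is an identity in the pendant family**: if `o` is a leaf whose unique edge `e` goes to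
`y ≠ o`, and `s, u ≠ o`, then `XW(p) = 0`. -/
theorem xwBil_leaf_eq_zero (p : E → R) (ends : E → Sym2 V) {e : E} {s y o u : V}
    (hleaf : ∀ e', o ∈ ends e' → e' = e) (hends : ends e = s(y, o)) (hyo : y ≠ o) (hso : s ≠ o)
    (huo : u ≠ o) : xwBil ends s y o u p p = 0 := by
  classical
  unfold xwBil
  rw [connEvent_leaf_eq_openEdge hleaf hends hyo]
  have hdisj : Disjoint (({e} : Set E)ᶜ) ({e} : Set E) := disjoint_compl_left
  have ha := dependsOn_connEvent_of_leaf hleaf hends hyo hso huo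
  have hS := dependsOn_connEvent_of_leaf hleaf hends hyo hso hyo
  have hSa : DependsOn (· ∈ connEvent ends s y ∩ connEvent ends s u) (({e} : Set E)ᶜ) := by
    have := dependsOn_inter hS ha
    simpa using this
  rw [prob_inter_eq_mul_of_dependsOn p hdisj ha (dependsOn_openEdge e),
    prob_inter_eq_mul_of_dependsOn p hdisj hS (dependsOn_openEdge e),
    prob_inter_eq_mul_of_dependsOn p hdisj hSa (dependsOn_openEdge e), prob_openEdge]
  ring

end LeafIdentity

end Summit.Ventures.PercRepro2
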